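import Summits.QuantumFields.YangMills.Theorems.FluctuationComparisonRegPrIntLS2BetaSqrtGaugeStageTBoxBlock
import Summits.QuantumFields.YangMills.Theorems.FluctuationComparisonRegPrIntLS2BetaSlowTubeConeCentre
import HarnessLib

/-!
# S2β · D-GUARD ∕ (BG∞) — THE TUBE SECTION OF A BOX-BLOCK ((F2) part 1∕2: the SITE-LEVEL Stage-T section discharging px19 g25's filling letter FILL₂ of
# `hSec_of_fillings` in the oriented slow case): in dimension `3`, on a box of sides `n` (per axis) at corner `s`, a datum `ψ : Site → SU2` whose bonds with both
# ends on the `(α, β)`-tube are `ε`-slow admits a section `W : Site → SU2` equal to `ψ` on the tube and `B`-slow on every bond of the box, for any `B`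
# dominating `12Λε + 6(π−r)∕n α` and `Λε` — centre from ✓p840318 (tube), operator from ✓p840356 (rectangle cone), laws from ✓p840380 ((L-T)′), sites ↔
# offsets by ✓p839889

Cell `ym3-torus` (YM ladder rung R3 = continuum `SU(2)` Yang–Mills on the three-torus at fixed lattice data — a RUNG: NOT d = 4, NOT infinite volume,
NOT a mass gap, NOT Clay).  Width seat «width 5» `ym3-torus-px5` (gen 24), FREE px helper on crux `stmt-QuantumFields-20520` (`FluctuationComparisonRegPrIntL`;
registry `Lines/semiclassical_s2beta.lean` UNTOUCHED, 0∕5); `--kind proof --supports stmt-QuantumFields-20520 --as helper`, count-neutral, DEFINITION-FREE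
(0 `def`, 0 `instance`, 0 `notation`, 0 `sorry`, default heartbeats).  Currency of px19's `hSec_of_fillings` letter `h₂` (box `∀ κ, (x κ − (s κ : ZMod N)).val ≤ n κ`,
tube `t_α ∈ {0, n α} ∨ t_β ∈ {0, n β}`), at a general level `j`.

WHY.  `hBG ⟸ hSec` (✓p840037) `⟸ FILL₁ ∧ FILL₂ ∧ FILL₃` (px19's (Σ-B5) `hSec_of_fillings`, sorry-free); FILL₂ = «Stage T on a box-block, at the site level,
with universal constants».  This file is the geometric core of FILL₂ with the numerics as displayed hypotheses (`r`, `m`, `hrad`, `hcard`, `hB1`, `hB2`); part 2∕2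
fixes the numbers (`r(E)`, `m(E, ρ)`, `A(E)`, `ρ₀ := 2`), swaps `α ↔ β` when `n α < n β`, and serves the non-slow case by `W := ψ`.

WHAT IS PROVED (sorry-free).
* §1 `exists_third_axis` (`P.d = 3`: a third axis, and the three exhaust `Fin P.d`), `eq_update3` (an offset vector from its three coordinates).
* §2 `offset_siteOf` ∕ `siteOf_offset` ∕ `tgt_siteOf` — sites `κ ↦ s κ + u κ` of offset vectors and back (✓`eq_natCast_add_offset`), bonds from them.
* §3 `upd3_apply_fst∕snd∕thd` — coordinates of `z|_{α↦i, β↦k, γ↦l}`.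
* §4 ★★★ `tube_section (hd : P.d = 3) (n s) (hN : ∀ κ, n κ + 1 < N) (hαβ) (hnβ : 2 ≤ n β) (hβα : n β ≤ n α) (hαβ2 : n α ≤ 2·n β) (ψ) (hε : 0 ≤ ε) (hr : 0 < r)
  (hrπ : 3r∕2 ≤ π) (m) (hm) (hrad) (hcard) (hB1) (hB2) (hletters : tube bonds of ψ are ε-slow) : ∃ W : Site P j → SU2, (W = ψ on the tube of the box) ∧
  (every bond of the box has dist1 (W src·(W tgt)⁻¹) ≤ B)`.

HONEST SCOPE.  Composition + site∕offset bookkeeping over landed bricks; no gauge field; nothing of Bałaban's renormalisation-group analysis is asserted or proved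
([Balaban1985RegularSpaces] Lemma 1 p.79, Thm 2 p.83 — local small gauges).  FILL₂ (part 2), `hSec` ∕ (BG∞) ∕ `hsupp⁺` are HYPOTHESES∕CONJECTURES (plan §116) and
NOT proved here; GAP♯∘ (registry UNTOUCHED), the five registered stubs (0∕5), S2β, 20520, 19936, 19200, `YM3TorusSU2` are NOT proved; no registered stub is
closed; rung R3 — NOT d = 4, NOT infinite volume, NOT a mass gap, NOT Clay; the Yang–Mills mass gap is NOT proved.  Axioms standard.

References: T. Bałaban, CMP **99** (1985) 75–102 [Balaban1985RegularSpaces] (Lemma 1 p.79, Thm 2 p.83).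
-/

set_option autoImplicit false

noncomputable section

namespace Summit.QuantumFields.YangMills.Theorems.FluctuationComparisonRegPrIntLS2BetaSqrtGaugeFillingTubeSection

open scoped Real
open Literature.MathematicalPhysics.QuantumLattice (su2Quat)
open Literature.MathematicalPhysics.QuantumFieldTheory.Balaban1983to89
open T4CubeChartGnomonic (SU2)
open T4ExpWindowSmallField (logVec)
open Summit.QuantumFields.YangMills.Theorems.FluctuationComparisonRegPrIntLS2BetaBlockOffsetCoordinates (eq_natCast_add_offset read_tgt_eq)

variable {P : Params} {j : ℕ}

/-! ## §1 Three axes -/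

/-- In dimension `3`, two distinct axes have a third one, and the three exhaust all axes. [folklore] -/
theorem exists_third_axis (hd : P.d = 3) (α β : Fin P.d) (hαβ : α ≠ β) :
    ∃ γ : Fin P.d, γ ≠ α ∧ γ ≠ β ∧ ∀ κ : Fin P.d, κ = α ∨ κ = β ∨ κ = γ := by
  have hcard : Fintype.card (Fin P.d) = 3 := by rw [Fintype.card_fin, hd]
  -- a third axis exists
  have hex : ∃ γ : Fin P.d, γ ≠ α ∧ γ ≠ β := by
    by_contra h
    push Not at h
    have hsub : (Finset.univ : Finset (Fin P.d)) ⊆ {α, β} := by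
      intro κ _
      rcases eq_or_ne κ α with h1 | h1
      · simp [h1]
      · simp [h κ h1]
    have := Finset.card_le_card hsub
    rw [Finset.card_univ, hcard] at this
    have h2 : ({α, β} : Finset (Fin P.d)).card ≤ 2 := Finset.card_le_two
    omega
  obtain ⟨γ, hγα, hγβ⟩ := hex
  refine ⟨γ, hγα, hγβ, fun κ => ?_⟩
  by_contra h
  push Not at h
  obtain ⟨h1, h2, h3⟩ := h
  have hsub : ({α, β, γ, κ} : Finset (Fin P.d)) ⊆ Finset.univ := Finset.subset_univ _
  have hc := Finset.card_le_card hsub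
  rw [Finset.card_univ, hcard] at hc
  have h4 : ({α, β, γ, κ} : Finset (Fin P.d)).card = 4 := by
    rw [Finset.card_insert_of_notMem (by simp [hαβ, Ne.symm hγα, Ne.symm h1]),
      Finset.card_insert_of_notMem (by simp [Ne.symm hγβ, Ne.symm h2]),
      Finset.card_insert_of_notMem (by simp [Ne.symm h3]), Finset.card_singleton]
  omega

/-- In dimension `3` an offset vector is rebuilt from its three coordinates. [folklore] -/
theorem eq_update3 {α β γ : Fin P.d} (hall : ∀ κ : Fin P.d, κ = α ∨ κ = β ∨ κ = γ) (hαβ : α ≠ β) (hγα : γ ≠ α) (hγβ : γ ≠ β)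
    (z u : Fin P.d → ℕ) :
    u = Function.update (Function.update (Function.update z α (u α)) β (u β)) γ (u γ) := by
  funext κ
  rcases hall κ with h | h | h
  · subst h
    rw [Function.update_of_ne (Ne.symm hγα), Function.update_of_ne hαβ, Function.update_self]
  · subst h
    rw [Function.update_of_ne (Ne.symm hγβ), Function.update_self]
  · subst h
    rw [Function.update_self]

/-! ## §2 Sites of offset vectors -/

/-- The offsets of the site `κ ↦ s κ + u κ` are `u` (no wrap: `u κ < N`). [folklore] -/
theorem offset_siteOf (s u : Fin P.d → ℕ) (hu : ∀ κ, u κ < P.sitesPerDir j) (κ : Fin P.d) :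
    ((fun μ => ((s μ : ℕ) : ZMod (P.sitesPerDir j)) + ((u μ : ℕ) : ZMod (P.sitesPerDir j))) κ
        - ((s κ : ℕ) : ZMod (P.sitesPerDir j))).val = u κ := by
  haveI : NeZero (P.sitesPerDir j) := ⟨P.sitesPerDir_ne_zero j⟩
  simp only [add_sub_cancel_left, ZMod.val_natCast, Nat.mod_eq_of_lt (hu κ)]

/-- The site of the offsets of `x` is `x`. [folklore] -/
theorem siteOf_offset (s : Fin P.d → ℕ) (x : Site P j) :
    (fun μ => ((s μ : ℕ) : ZMod (P.sitesPerDir j)) + (((x μ - ((s μ : ℕ) : ZMod (P.sitesPerDir j))).val : ℕ) : ZMod (P.sitesPerDir j))) = x := by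
  funext μ
  exact (eq_natCast_add_offset s x μ).symm

/-- The bond from the site of `u` in direction `κ` ends at the site of `update u κ (u κ + 1)`. [folklore] -/
theorem tgt_siteOf (s u : Fin P.d → ℕ) (κ : Fin P.d) :
    (PBond.mk (fun μ => ((s μ : ℕ) : ZMod (P.sitesPerDir j)) + ((u μ : ℕ) : ZMod (P.sitesPerDir j))) κ : PBond P j).tgt =
      fun μ => ((s μ : ℕ) : ZMod (P.sitesPerDir j)) + ((Function.update u κ (u κ + 1) μ : ℕ) : ZMod (P.sitesPerDir j)) := by
  funext μ
  show Function.update _ κ _ μ = _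
  by_cases h : μ = κ
  · subst h
    rw [Function.update_self, Function.update_self]
    push_cast; ring
  · rw [Function.update_of_ne h, Function.update_of_ne h]

/-! ## §3 Coordinates of the three-axis vector `z|_{α↦i, β↦k, γ↦l}` -/

/-- The `α`-coordinate. [folklore] -/
theorem upd3_apply_fst {α β γ : Fin P.d} (hαβ : α ≠ β) (hγα : γ ≠ α) (z : Fin P.d → ℕ) (i k l : ℕ) :
    Function.update (Function.update (Function.update z α i) β k) γ l α = i := by
  rw [Function.update_of_ne (Ne.symm hγα), Function.update_of_ne hαβ, Function.update_self]

/-- The `β`-coordinate. [folklore] -/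
theorem upd3_apply_snd (α : Fin P.d) {β γ : Fin P.d} (hγβ : γ ≠ β) (z : Fin P.d → ℕ) (i k l : ℕ) :
    Function.update (Function.update (Function.update z α i) β k) γ l β = k := by
  rw [Function.update_of_ne (Ne.symm hγβ), Function.update_self]

/-- The `γ`-coordinate. [folklore] -/
theorem upd3_apply_thd (α β γ : Fin P.d) (z : Fin P.d → ℕ) (i k l : ℕ) :
    Function.update (Function.update (Function.update z α i) β k) γ l γ = l := by
  rw [Function.update_self]

/-! ## §4 The oriented tube section (slow case, `n β ≤ n α`) -/

/-- ★★★ **THE TUBE SECTION OF A BOX-BLOCK (oriented, slow data)**: in dimension `3`, on the box of sides `n` at corner `s` with `2 ≤ n β ≤ n α ≤ 2·n β` and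
`n κ + 1 < N`, a datum `ψ` whose bonds with both ends on the `(α, β)`-tube of the box are `ε`-slow, a radius `0 < r`, `3r∕2 ≤ π`, a subsampling step `m` with the two
packing numerics of ✓`exists_tubeCentre`, admit a section `W` equal to `ψ` on the tube and with every bond of the box bounded by any `B` dominating
`12Λε + 6(π−r)∕n α` and `Λε` (`Λ = (π−r)∕sin r`): centre from ✓p840318, operator from ✓p840356, laws from ✓p840380. [cite: Balaban1985RegularSpaces, Thm 2 p.83] -/
theorem tube_section (hd : P.d = 3) (n s : Fin P.d → ℕ) (hN : ∀ κ, n κ + 1 < P.sitesPerDir j)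
    {α β : Fin P.d} (hαβ : α ≠ β) (hnβ : 2 ≤ n β) (hβα : n β ≤ n α) (hαβ2 : n α ≤ 2 * n β)
    (ψ : Site P j → SU2) {ε r B : ℝ} (hε : 0 ≤ ε) (hr : 0 < r) (hrπ : 3 * r / 2 ≤ π)
    (m : ℕ) (hm : 1 ≤ m) (hrad : π / 2 * (((2 * (m - 1) : ℕ) : ℝ) * ε) ≤ r / 2)
    (hcard : ∀ nγ : ℕ, (∃ κ, nγ = n κ) →
      ((2 * ((n β / m + 1) * (nγ / m + 1)) + 2 * ((n α / m + 1) * (nγ / m + 1)) : ℕ) : ℝ) * (2 / (3 * π) * (3 * r / 2) ^ 3) < 1)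
    (hB1 : 12 * ((π - r) / Real.sin r) * ε + 6 * (π - r) / (n α) ≤ B) (hB2 : ((π - r) / Real.sin r) * ε ≤ B)
    (hletters : ∀ b : PBond P j, (∀ κ, (b.src κ - ((s κ : ℕ) : ZMod (P.sitesPerDir j))).val ≤ n κ) →
      (∀ κ, (b.tgt κ - ((s κ : ℕ) : ZMod (P.sitesPerDir j))).val ≤ n κ) →
      (((b.src α - ((s α : ℕ) : ZMod (P.sitesPerDir j))).val = 0 ∨ (b.src α - ((s α : ℕ) : ZMod (P.sitesPerDir j))).val = n α) ∨
        ((b.src β - ((s β : ℕ) : ZMod (P.sitesPerDir j))).val = 0 ∨ (b.src β - ((s β : ℕ) : ZMod (P.sitesPerDir j))).val = n β)) →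
      (((b.tgt α - ((s α : ℕ) : ZMod (P.sitesPerDir j))).val = 0 ∨ (b.tgt α - ((s α : ℕ) : ZMod (P.sitesPerDir j))).val = n α) ∨
        ((b.tgt β - ((s β : ℕ) : ZMod (P.sitesPerDir j))).val = 0 ∨ (b.tgt β - ((s β : ℕ) : ZMod (P.sitesPerDir j))).val = n β)) →
      dist1 (ψ b.src * (ψ b.tgt)⁻¹) ≤ ε) :
    ∃ W : Site P j → SU2,
      (∀ x : Site P j, (∀ κ, (x κ - ((s κ : ℕ) : ZMod (P.sitesPerDir j))).val ≤ n κ) →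
        (((x α - ((s α : ℕ) : ZMod (P.sitesPerDir j))).val = 0 ∨ (x α - ((s α : ℕ) : ZMod (P.sitesPerDir j))).val = n α) ∨
          ((x β - ((s β : ℕ) : ZMod (P.sitesPerDir j))).val = 0 ∨ (x β - ((s β : ℕ) : ZMod (P.sitesPerDir j))).val = n β)) → W x = ψ x) ∧
      (∀ b : PBond P j, (∀ κ, (b.src κ - ((s κ : ℕ) : ZMod (P.sitesPerDir j))).val ≤ n κ) →
        (∀ κ, (b.tgt κ - ((s κ : ℕ) : ZMod (P.sitesPerDir j))).val ≤ n κ) →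
        dist1 (W b.src * (W b.tgt)⁻¹) ≤ B) := by
  haveI : NeZero (P.sitesPerDir j) := ⟨P.sitesPerDir_ne_zero j⟩
  obtain ⟨γ, hγα, hγβ, hall⟩ := exists_third_axis hd α β hαβ
  have hrπ' : r < π := by linarith
  have hr0 : 0 ≤ r := hr.le
  -- the datum read on offset vectors, and on triples
  set φ : (Fin P.d → ℕ) → SU2 := fun u => ψ (fun μ => ((s μ : ℕ) : ZMod (P.sitesPerDir j)) + ((u μ : ℕ) : ZMod (P.sitesPerDir j))) with hφ
  set z : Fin P.d → ℕ := fun _ => 0 with hz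
  -- a vector with small coordinates has small entries everywhere
  have hsmall : ∀ u : Fin P.d → ℕ, u α ≤ n α → u β ≤ n β → u γ ≤ n γ → ∀ κ, u κ < P.sitesPerDir j := by
    intro u h1 h2 h3 κ
    rcases hall κ with h | h | h
    · rw [h]; have := hN α; omega
    · rw [h]; have := hN β; omega
    · rw [h]; have := hN γ; omega
  -- the letter for a bond from the site of `u` in direction `κ`
  have hbond : ∀ (u : Fin P.d → ℕ) (κ : Fin P.d), u α ≤ n α → u β ≤ n β → u γ ≤ n γ →
      Function.update u κ (u κ + 1) α ≤ n α → Function.update u κ (u κ + 1) β ≤ n β → Function.update u κ (u κ + 1) γ ≤ n γ →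
      (u α = 0 ∨ u α = n α ∨ u β = 0 ∨ u β = n β) →
      (Function.update u κ (u κ + 1) α = 0 ∨ Function.update u κ (u κ + 1) α = n α ∨
        Function.update u κ (u κ + 1) β = 0 ∨ Function.update u κ (u κ + 1) β = n β) →
      dist1 (φ u * (φ (Function.update u κ (u κ + 1)))⁻¹) ≤ ε := by
    intro u κ h1 h2 h3 h1' h2' h3' hb hb'
    have hu := offset_siteOf (j := j) s u (hsmall u h1 h2 h3)
    have hu' := offset_siteOf (j := j) s (Function.update u κ (u κ + 1)) (hsmall _ h1' h2' h3')
    have h := hletters ⟨(fun μ => ((s μ : ℕ) : ZMod (P.sitesPerDir j)) + ((u μ : ℕ) : ZMod (P.sitesPerDir j))), κ⟩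
    rw [tgt_siteOf] at h
    simp only [hu, hu'] at h
    refine h (fun κ' => ?_) (fun κ' => ?_) (by omega) (by omega)
    · rcases hall κ' with h | h | h <;> rw [h] <;> assumption
    · rcases hall κ' with h | h | h <;> rw [h] <;> assumption
  -- the tube letters of the triple datum
  have hcα : ∀ i k l : ℕ, Function.update (Function.update (Function.update z α i) β k) γ l α = i := upd3_apply_fst hαβ hγα z
  have hcβ : ∀ i k l : ℕ, Function.update (Function.update (Function.update z α i) β k) γ l β = k := upd3_apply_snd α hγβ z
  have hcγ : ∀ i k l : ℕ, Function.update (Function.update (Function.update z α i) β k) γ l γ = l := upd3_apply_thd α β γ z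
  have hrebuild : ∀ w : Fin P.d → ℕ, w = Function.update (Function.update (Function.update z α (w α)) β (w β)) γ (w γ) :=
    fun w => eq_update3 hall hαβ hγα hγβ z w
  -- stepping a triple vector in each direction
  have hstepα : ∀ i k l : ℕ, Function.update (Function.update (Function.update (Function.update z α i) β k) γ l) α (i + 1) =
      Function.update (Function.update (Function.update z α (i + 1)) β k) γ l := by
    intro i k l
    rw [hrebuild (Function.update _ α (i + 1)), Function.update_self, Function.update_of_ne (Ne.symm hαβ), Function.update_of_ne hγα, hcβ, hcγ]
  have hstepβ : ∀ i k l : ℕ, Function.update (Function.update (Function.update (Function.update z α i) β k) γ l) β (k + 1) =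
      Function.update (Function.update (Function.update z α i) β (k + 1)) γ l := by
    intro i k l
    rw [hrebuild (Function.update _ β (k + 1)), Function.update_self, Function.update_of_ne hαβ, Function.update_of_ne hγβ, hcα, hcγ]
  have hstepγ : ∀ i k l : ℕ, Function.update (Function.update (Function.update (Function.update z α i) β k) γ l) γ (l + 1) =
      Function.update (Function.update (Function.update z α i) β k) γ (l + 1) := by
    intro i k l
    rw [Function.update_idem]
  obtain ⟨a, ha⟩ := Summit.QuantumFields.YangMills.Theorems.FluctuationComparisonRegPrIntLS2BetaSlowTubeConeCentre.exists_tubeCentre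
    (n α) (n β) (n γ) m hm (fun p : ℕ × ℕ × ℕ => φ (Function.update (Function.update (Function.update z α p.1) β p.2.1) γ p.2.2))
    hε hr0 hrπ
    (fun i k l hi hk hl => by
      have h := hbond (Function.update (Function.update (Function.update z α i) β k) γ l) α
      simp only [hcα, hcβ, hcγ, hstepα] at h ⊢
      have h' := h (by omega) (by omega) hl
      exact h' (by omega) (by omega) hl (by omega) (by omega))
    (fun i k l hi hk hl => by
      have h := hbond (Function.update (Function.update (Function.update z α i) β k) γ l) β
      simp only [hcα, hcβ, hcγ, hstepβ] at h ⊢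
      have h' := h (by omega) (by omega) hl
      exact h' (by omega) (by omega) hl (by omega) (by omega))
    (fun i k l hi hk hb hl => by
      have h := hbond (Function.update (Function.update (Function.update z α i) β k) γ l) γ
      simp only [hcα, hcβ, hcγ, hstepγ] at h ⊢
      have h' := h hi hk (by omega)
      exact h' hi hk hl hb hb)
    hrad (hcard (n γ) ⟨γ, rfl⟩)
  -- the rectangle operator at the centre `a`, and the block section
  obtain ⟨Wr, hWr⟩ := Summit.QuantumFields.YangMills.Theorems.FluctuationComparisonRegPrIntLS2BetaConeOnRectangle.exists_coneOnRect
    (n α) (n β) hnβ hβα hαβ2 hr hrπ' a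
  set Wb : (Fin P.d → ℕ) → SU2 := fun u => Wr (fun p => φ (Function.update (Function.update u α p.1) β p.2)) (u α, u β) with hWb
  have hWb' : ∀ t, Wb t = Wr (fun p => φ (Function.update (Function.update t α p.1) β p.2)) (t α, t β) := fun t => rfl
  -- in a slice, the third coordinate is that of the base
  have hsliceγ : ∀ u t : Fin P.d → ℕ, Function.update (Function.update u α (t α)) β (t β) = t → u γ = t γ := by
    intro u t h
    have := congrArg (fun f => f γ) h
    simpa [Function.update_of_ne hγβ, Function.update_of_ne hγα] using this
  -- the ring cap of every slice, from the tube centre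
  have hcapOf : ∀ t : Fin P.d → ℕ, t γ ≤ n γ → ∀ u : Fin P.d → ℕ,
      Function.update (Function.update u α (t α)) β (t β) = t → u α ≤ n α → u β ≤ n β →
      (u α = 0 ∨ u α = n α ∨ u β = 0 ∨ u β = n β) → ‖logVec (su2Quat (a⁻¹ * φ u))‖ ≤ π - r := by
    intro t ht u hu h1 h2 hb
    have hγ := hsliceγ u t hu
    have h := ha (u α) (u β) (u γ) h1 h2 (by omega) hb
    rw [← hrebuild u] at h
    exact h
  -- the per-bond ring letters of every slice
  have hstepOf : ∀ t : Fin P.d → ℕ, t γ ≤ n γ → ∀ u : Fin P.d → ℕ, ∀ κ : Fin P.d, (κ = α ∨ κ = β) →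
      Function.update (Function.update u α (t α)) β (t β) = t →
      u α ≤ n α → u β ≤ n β → (u α = 0 ∨ u α = n α ∨ u β = 0 ∨ u β = n β) →
      Function.update u κ (u κ + 1) α ≤ n α → Function.update u κ (u κ + 1) β ≤ n β →
      (Function.update u κ (u κ + 1) α = 0 ∨ Function.update u κ (u κ + 1) α = n α ∨
        Function.update u κ (u κ + 1) β = 0 ∨ Function.update u κ (u κ + 1) β = n β) →
      dist1 (φ u * (φ (Function.update u κ (u κ + 1)))⁻¹) ≤ ε := by
    intro t ht u κ hκ hu h1 h2 hb h1' h2' hb'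
    have hγ := hsliceγ u t hu
    have hκγ : κ ≠ γ := by rcases hκ with h | h <;> rw [h]; exacts [Ne.symm hγα, Ne.symm hγβ]
    have h3' : Function.update u κ (u κ + 1) γ ≤ n γ := by rw [Function.update_of_ne (Ne.symm hκγ)]; omega
    exact hbond u κ h1 h2 (by omega) h1' h2' h3' hb hb'
  -- the across-slice letters
  have hcloseOf : ∀ t : Fin P.d → ℕ, t γ + 1 ≤ n γ → ∀ u : Fin P.d → ℕ,
      Function.update (Function.update u α (t α)) β (t β) = t → u α ≤ n α → u β ≤ n β →
      (u α = 0 ∨ u α = n α ∨ u β = 0 ∨ u β = n β) → dist1 (φ u * (φ (Function.update u γ (u γ + 1)))⁻¹) ≤ ε := by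
    intro t ht u hu h1 h2 hb
    have hγ := hsliceγ u t hu
    refine hbond u γ h1 h2 (by omega) ?_ ?_ ?_ hb ?_
    · rw [Function.update_of_ne (Ne.symm hγα)]; exact h1
    · rw [Function.update_of_ne (Ne.symm hγβ)]; exact h2
    · rw [Function.update_self]; omega
    · rw [Function.update_of_ne (Ne.symm hγα), Function.update_of_ne (Ne.symm hγβ)]; exact hb
  refine ⟨fun x => Wb (fun κ => (x κ - ((s κ : ℕ) : ZMod (P.sitesPerDir j))).val), fun x hx htube => ?_, fun b hsrc htgt => ?_⟩
  · -- (i) ring agreement, then the site of the offsets of `x` is `x`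
    have h := Summit.QuantumFields.YangMills.Theorems.FluctuationComparisonRegPrIntLS2BetaSqrtGaugeStageTBoxBlock.stageT_ring_eq
      φ a α β (n α) (n β) r Wr hWr Wb hWb' hαβ (fun κ => (x κ - ((s κ : ℕ) : ZMod (P.sitesPerDir j))).val) (hx α) (hx β)
      (by rcases htube with (h | h) | (h | h) <;> simp [h]) (hcapOf (fun κ => (x κ - ((s κ : ℕ) : ZMod (P.sitesPerDir j))).val) (hx γ))
    show Wb (fun κ => (x κ - ((s κ : ℕ) : ZMod (P.sitesPerDir j))).val) = ψ x
    rw [h, hφ]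
    simp only
    rw [siteOf_offset s x]
  · -- (ii) the bond laws by direction
    have hNb : (b.src b.dir - ((s b.dir : ℕ) : ZMod (P.sitesPerDir j))).val + 1 < P.sitesPerDir j := by
      have := hsrc b.dir; have := hN b.dir; omega
    have htgt' := Summit.QuantumFields.YangMills.Theorems.FluctuationComparisonRegPrIntLS2BetaBlockOffsetCoordinates.offsets_tgt_eq_update s b hNb
    -- target offsets: the source's, stepped in direction `b.dir`
    have htgtd : ∀ κ, (b.tgt κ - ((s κ : ℕ) : ZMod (P.sitesPerDir j))).val =
        Function.update (fun κ => (b.src κ - ((s κ : ℕ) : ZMod (P.sitesPerDir j))).val) b.dir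
          ((b.src b.dir - ((s b.dir : ℕ) : ZMod (P.sitesPerDir j))).val + 1) κ := fun κ => congrArg (fun f => f κ) htgt'
    show dist1 (Wb (fun κ => (b.src κ - ((s κ : ℕ) : ZMod (P.sitesPerDir j))).val) *
      (Wb (fun κ => (b.tgt κ - ((s κ : ℕ) : ZMod (P.sitesPerDir j))).val))⁻¹) ≤ B
    rw [read_tgt_eq Wb s b hNb]
    set t : Fin P.d → ℕ := fun κ => (b.src κ - ((s κ : ℕ) : ZMod (P.sitesPerDir j))).val with ht
    have htα := htgt α; have htβ := htgt β; have htγ := htgt γ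
    rw [htgtd] at htα htβ htγ
    rcases hall b.dir with hdir | hdir | hdir
    · rw [hdir] at htα htβ htγ ⊢
      rw [Function.update_self] at htα
      rw [Function.update_of_ne (Ne.symm hαβ)] at htβ
      exact (Summit.QuantumFields.YangMills.Theorems.FluctuationComparisonRegPrIntLS2BetaSqrtGaugeStageTBoxBlock.dist1_stageT_step_fst_le
        φ a α β (n α) (n β) r Wr hWr Wb hWb' hαβ t htα htβ (hcapOf t (hsrc γ)) hε (hstepOf t (hsrc γ))).trans hB1
    · rw [hdir] at htα htβ htγ ⊢
      rw [Function.update_of_ne hαβ] at htα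
      rw [Function.update_self] at htβ
      exact (Summit.QuantumFields.YangMills.Theorems.FluctuationComparisonRegPrIntLS2BetaSqrtGaugeStageTBoxBlock.dist1_stageT_step_snd_le
        φ a α β (n α) (n β) r Wr hWr Wb hWb' hαβ t htα htβ (hcapOf t (hsrc γ)) hε (hstepOf t (hsrc γ))).trans hB1
    · rw [hdir] at htα htβ htγ ⊢
      rw [Function.update_self] at htγ
      have hcap' := hcapOf (Function.update t γ (t γ + 1)) (by rw [Function.update_self]; exact htγ)
      rw [Function.update_of_ne (Ne.symm hγα), Function.update_of_ne (Ne.symm hγβ)] at hcap'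
      exact (Summit.QuantumFields.YangMills.Theorems.FluctuationComparisonRegPrIntLS2BetaSqrtGaugeStageTBoxBlock.dist1_stageT_step_of_ne_le
        φ a α β (n α) (n β) r Wr hWr Wb hWb' hαβ hγα hγβ t (hsrc α) (hsrc β) (hcapOf t (hsrc γ)) hcap' (hcloseOf t htγ)).trans hB2

end Summit.QuantumFields.YangMills.Theorems.FluctuationComparisonRegPrIntLS2BetaSqrtGaugeFillingTubeSection

end
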